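import Literature.NumberTheory.LFunctions.TrilinearKloostermanFractionsFromOffDiag
import HarnessLib

/-!
# Bettin–Chandee's Theorem 1 ⇐ the off-diagonal bound (4.25) (fact split)

Topic `NumberTheory/LFunctions`. Fact-decomposition file (librarian, mode `fact-decompose`,
2026-08-16) for the named fact
`Literature.NumberTheory.LFunctions.BettinChandee2018_trilinearKloostermanFractions`
(`BettinChandee2018TrilinearKloostermanFractions.lean`; S. Bettin, V. Chandee, *Trilinear forms
with Kloosterman fractions*, Adv. Math. 328 (2018) 1234–1262 = arXiv:1502.00769, **Theorem 1**).

The tree has PROVED every section of the printed proof except §4: §2 (reduction to `β` coprime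
to `ϑ`, Cauchy–Schwarz, amplification — `TrilinearKloostermanFractionsFromC1.lean`,
`…AmplifiedForm.lean`), §3 (the diagonal terms (3.5) — `BC_diagA_bound`,
`…Diagonal.lean`), §5 ((5.1)–(5.2) and the choice of `L` — `…From51.lean`, `…OptimiseL.lean`),
§6 ((6.1)–(6.4), squarefull decomposition, Weil range — `…FromCb.lean`, `…WeilRange.lean`),
§7 and Remark 2 (reciprocity, `M < N` — `…Reciprocity.lean`), assembled as
`BettinChandee2018_trilinearKloostermanFractions_of_offA (hO)` (`…FromOffDiag.lean`): the named
fact from the **off-diagonal bound (4.25)** alone, for the general-`A`, twisted, amplified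
second moment with a fixed squarefull `b`.  Towards (4.25) itself the tree already proves the
pair phase and Weil's bound for the `n₂`-sum of an off-diagonal pair (`…OffTuple.lean`,
`…OffPairPhase.lean`, `…OffPairWeil.lean`, `…AbelMonotone.lean`; §4.1.3); the assembly of §4
((4.1)–(4.25): the Δ = 0 terms §4.1.1–4.1.2, the Δ ≠ 0 terms §4.1.3, and the summation over
`d, d', ℓ's, a's`) is what remains.

This file NAMES that remaining input (`BettinChandee2018_offDiagonal_bound`, the hypothesis `hO`
verbatim) and records the PROVED assembly
`BettinChandee2018_trilinearKloostermanFractions_holds_of`.  The child is a bound for the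
off-diagonal part of an amplified second moment — an intermediate display of the printed proof,
not a restatement of Theorem 1.

## References

* S. Bettin, V. Chandee, Adv. Math. 328 (2018) 1234–1262 (arXiv:1502.00769), Theorem 1, §4
  ((4.1)–(4.25)), §§2–7. [BettinChandee2018]
* W. Duke, J. Friedlander, H. Iwaniec, Invent. Math. 128 (1997) 23–43, §4. [DukeFriedlanderIwaniec1997]
-/

noncomputable section

open Finset Real

namespace Literature.NumberTheory.LFunctions

/-- **Bettin–Chandee 2018, §4, the off-diagonal bound (4.25)**, for the general-`A`, TWISTED
(Remark 2, factor with exponent `1`), amplified second moment with a fixed squarefull `b` coprime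
to `ϑ`: printed (4.25)
`∑_m Off_m(c) ≪ ‖γ‖²‖ν‖² x^ε W b^{1/2} A L N'^{3/4} (b^{1/4} N'^{1/2} L^{1/2} M^{-1/2} + L^{5/2} N'/M + N'^{1/4} A^{-1/2})`
for the off-diagonal part (`ℓ₁n₁ ≠ ℓ₂n₂`, `ℓ₁n₁ ≡ ℓ₂n₂ (mod m)`) of the orthogonality expansion of
`∑_{m ∼ M, (m,b)=1} |∑_{ℓ ∈ 𝓛} ∑_{n} c_m(ℓ n)|²` with coefficients
`c_m(n') = γ_{n'} ∑_a ν_a e(ϑ a m̄/(bn') + η a/(m bn'))`, `γ` supported on squarefree `n' ∼ N'`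
coprime to `bϑ`, amplifier `𝓛 = {ℓ ∈ (L, 2L] prime, (ℓ, bϑ) = 1}`, every integer `L ≥ 1`, in
the ranges `b ≤ N'`, `bN' ≤ M`, `A ≥ 1/2` (the source's `M^ε` as `((1+|ϑ|+|η|) b M N' A)^ε`).
Printed proof: §4.1.1–4.1.2 (the terms with `Δ := ℓ₁n₁ − ℓ₂n₂ ≡ 0`, counted directly), §4.1.3
(`Δ ≠ 0`: Poisson in `n₂` / Weil's bound for incomplete Kloosterman sums, (gwp)–(boudn) — the
`n₂`-sum bound is the tree's `BC_pair_sum2_le`), and the summation (4.20)–(4.25).  This is the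
hypothesis `hO` of the tree's `BettinChandee2018_trilinearKloostermanFractions_of_offA`,
verbatim. [cite: BettinChandee2018, §4, (4.25)] -/
def BettinChandee2018_offDiagonal_bound : Prop :=
  ∀ ε : ℝ, 0 < ε → ∃ K : ℝ, 0 < K ∧ ∀ (b : ℕ), 0 < b → (∀ p ∈ b.primeFactors, p ^ 2 ∣ b) →
    ∀ (M N' A : ℝ), 1 / 2 ≤ M → 1 / 2 ≤ N' → (b : ℝ) ≤ N' → (b : ℝ) * N' ≤ M → 1 / 2 ≤ A →
    ∀ (ϑ : ℤ), ϑ ≠ 0 → b.Coprime ϑ.natAbs → ∀ (η : ℝ) (γ ν : ℕ → ℂ),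
      (∀ n : ℕ, γ n ≠ 0 → N' < n ∧ (n : ℝ) ≤ 2 * N') →
      (∀ n : ℕ, γ n ≠ 0 → Squarefree n ∧ n.Coprime b ∧ n.Coprime ϑ.natAbs) →
      (∀ a : ℕ, ν a ≠ 0 → A < a ∧ (a : ℝ) ≤ 2 * A) →
      ∀ L : ℕ, 1 ≤ L →
      ‖∑ m ∈ (Ioc ⌊M⌋₊ ⌊2 * M⌋₊).filter (fun m => m.Coprime b), ∑ ℓ₁ ∈ ((Ioc L (2 * L)).filter (fun ℓ => ℓ.Prime ∧ ℓ.Coprime b ∧ ℓ.Coprime ϑ.natAbs)), ∑ n₁ ∈ Icc 1 ⌊2 * N'⌋₊,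
        ∑ ℓ₂ ∈ ((Ioc L (2 * L)).filter (fun ℓ => ℓ.Prime ∧ ℓ.Coprime b ∧ ℓ.Coprime ϑ.natAbs)), ∑ n₂ ∈ Icc 1 ⌊2 * N'⌋₊,
          (if ℓ₁ * n₁ = ℓ₂ * n₂ then 0 else
          (if (ℓ₂ * n₂).Coprime m ∧ ((ℓ₁ * n₁ : ℕ) : ZMod m) = ((ℓ₂ * n₂ : ℕ) : ZMod m) then
            (γ n₁ * ∑ a ∈ Icc 1 ⌊2 * A⌋₊, ν a * Complex.exp (2 * Real.pi * Complex.I *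
              ((ϑ : ℂ) * (a : ℂ) * ((((m : ZMod (b * n₁))⁻¹).val : ℕ) : ℂ) / ((b * n₁ : ℕ) : ℂ) +
                (η : ℂ) * (a : ℂ) / ((m : ℂ) * ((b * n₁ : ℕ) : ℂ))))) *
            (starRingEnd ℂ) (γ n₂ * ∑ a ∈ Icc 1 ⌊2 * A⌋₊, ν a * Complex.exp (2 * Real.pi * Complex.I *
              ((ϑ : ℂ) * (a : ℂ) * ((((m : ZMod (b * n₂))⁻¹).val : ℕ) : ℂ) / ((b * n₂ : ℕ) : ℂ) +
                (η : ℂ) * (a : ℂ) / ((m : ℂ) * ((b * n₂ : ℕ) : ℂ))))) else 0))‖ ≤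
        K * (∑ n ∈ Icc 1 ⌊2 * N'⌋₊, ‖γ n‖ ^ 2) * (∑ a ∈ Icc 1 ⌊2 * A⌋₊, ‖ν a‖ ^ 2) *
          ((1 + |(ϑ : ℝ)| + |η|) * ((b : ℝ) * M * N' * A)) ^ ε * (1 + (|(ϑ : ℝ)| + |η|) * A / ((b : ℝ) * N' * M)) *
          ((b : ℝ) ^ (1 / 2 : ℝ) * A * (L : ℝ) * N' ^ (3 / 4 : ℝ) *
            ((b : ℝ) ^ (1 / 4 : ℝ) * N' ^ (1 / 2 : ℝ) * (L : ℝ) ^ (1 / 2 : ℝ) * M ^ (-(1 / 2) : ℝ) +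
              (L : ℝ) ^ (5 / 2 : ℝ) * N' / M + N' ^ (1 / 4 : ℝ) * A ^ (-(1 / 2) : ℝ)))

/-- **Assembly (fact split): Bettin–Chandee's Theorem 1 from the off-diagonal bound (4.25)** —
everything else of the printed proof being proved in the tree
(`BettinChandee2018_trilinearKloostermanFractions_of_offA`). [cite: BettinChandee2018, Theorem 1 and (4.25)] -/
theorem BettinChandee2018_trilinearKloostermanFractions_holds_of
    (hO : BettinChandee2018_offDiagonal_bound) :
    BettinChandee2018_trilinearKloostermanFractions :=
  BettinChandee2018_trilinearKloostermanFractions_of_offA hO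

end Literature.NumberTheory.LFunctions

end
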